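import Summits.NavierStokesRegularity.NavierStokesRegularity.Theorems.AdaptedFrequencyFrequencyRigidityOfLiouville
import Summits.NavierStokesRegularity.NavierStokesRegularity.Theorems.AdaptedFrequencyFrequencyRigidityAncientDriftNormalForm
import Summits.NavierStokesRegularity.NavierStokesRegularity.Theorems.AdaptedFrequencyFrequencyRigidityGalileanOseenIdentity
import Summits.NavierStokesRegularity.NavierStokesRegularity.Theorems.HardyPointSinkHardyAncientLimitClassical
import Summits.NavierStokesRegularity.NavierStokesRegularity.Theses.ExtremalTypeIConstant
import Literature.Analysis.FluidPDE.TypeIAncientMild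
import Literature.Analysis.FluidPDE.KatoSymmetryCovariance
import HarnessLib

/-!
# Crux `FrequencyRigidity` (stmt-NavierStokesRegularity-2955), line `two-ended-pinning`:
# the SHARP upper arrow — the Type-I ancient Liouville statement (L′) = stmt-NavierStokesRegularity-4050
# implies the crux

Helper file (lands `--supports stmt-NavierStokesRegularity-2955`; theorems only).

The earlier upper arrow (`…OfLiouville.lean`, p107437) derived the crux from the KNSS Liouville conjecture
(L) = `LiouvilleConjectureNS` (bounded ancient mild solutions are constant; item stmt-NavierStokesRegularity-10661
/ 0057).  The tree also carries the strictly WEAKER Type-I statement (L′) as an ITEM: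
`Theses.ExtremalTypeIConstant.TypeIAncientLiouville` = stmt-NavierStokesRegularity-4050 (shared, same body, with
`Theses.SymmetryModuliCount.TypeIAncientLiouville`): every field which is jointly smooth on `(−∞,0) × ℝ³`,
divergence free, KNSS-mild in the Oseen gauge (`u(t) = e^{(t−s)Δ}u(s) − B¹_s(u,u)(t)` for ALL `s < t < 0`,
no parasitic drift) and Type-I in time (`‖u(t,x)‖ ≤ C/√(−t)`) vanishes.  This file proves

    (L′) = stmt-4050  ⇒  FrequencyRigidity   and   (L′) ⇒ Stub 3, (L′) ⇒ S3L,

so the crux closes the instant item 4050 does.  The only work is the change of GAUGE: a crux witness is a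
CLASSICAL flow `(u, p)` with an arbitrary smooth pressure, i.e. mild only up to KNSS's parasitic drift, whereas
(L′) speaks about the drift-free Oseen gauge and demands joint smoothness of the representative.  Both are
supplied by LANDED stubs of the line and tree facts:

* S3a `stub_ancientDriftNormalForm` (p107013): the intrinsic drift `β`, continuous on `(−∞,0)`,
  `‖β(t)‖ ≤ (8C + 32C₀C²)/√(−t)`, with `u(t) − e^{(t−s)Δ}u(s) + B¹_s(u,u)(t) ≡ β(t) − β(s)`;
* S3b `stub_galileanOseenIdentity` (p107082): in the frame `B_a(σ) = ∫ₐ^σ β` the field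
  `W_a(σ, z) = u(σ, z + B_a(σ)) − β(σ)` satisfies the zero-drift Oseen identity for `a < s < t < 0`;
* here: `W := W_{−1}` satisfies it for ALL `s < t < 0` (change of anchor = a constant space translation,
  `oseenDuhamel_comp_add_right`, `heatExtension_comp_add_right`), is continuous, Type-I with constant
  `C + (8C + 32C₀C²)`, has divergence-free slices, and is JOINTLY SMOOTH — its time translates `W(· − ε)` are
  bounded Oseen-mild ancient fields, smooth by KNSS 2009 Prop. 4.1 (the tree's
  `HardyAncientLimit.isSmoothSpaceTimeOn_of_oseen` over `knss2009_smoothing_holds`);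
* so (L′) gives `W ≡ 0`, i.e. `u(t, ·) ≡ β(t)`: every classical Type-I ancient flow (any `ν > 0`, after the
  viscosity normalisation `classical_viscosityNormalise`) has spatially constant slices, `curl u ≡ 0`, and a
  crux witness / flat inhabitant (`H(−1) > 0`) cannot exist.

Sandwich after this file (every arrow a tree theorem):
`(L) ⇒ (L′) = stmt-4050 ⇒ FrequencyRigidity ⇔ S3L ⇒ ∀ α, RSSLiouvilleBounded α` (p118721, p119711).
CONDITIONAL on (L′) only through the explicit hypothesis of the last five theorems; nothing is asserted.

## References

* G. Koch, N. Nadirashvili, G. Seregin, V. Šverák, *Liouville theorems for the Navier–Stokes equations and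
  applications*, Acta Math. 203 (2009) 83–105 = arXiv:0709.3599, §1 p. 3 ((L), parasitic solutions
  `u = b(t)`), §3 Lemma 3.1 and Remark 3.1 (the drift), §4 Prop. 4.1 (smoothing), §6 (Type-I ancient
  solutions). [KochNadirashviliSereginSverak2009]
* G. Seregin, V. Šverák, *On Type I singularities of the local axi-symmetric solutions of the Navier–Stokes
  equations*, Comm. PDE 34 (2009), §1 (1.1), Thm. 2.4. [SereginSverak2009]
-/

set_option linter.dupNamespace false

noncomputable section

namespace Summit.NavierStokesRegularity.NavierStokesRegularity.Theorems.FrequencyRigidity.TwoEndedPinning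

open Literature.Analysis Literature.Analysis.FluidPDE MeasureTheory Set Filter Topology Function
open scoped RealInnerProductSpace

/-! ### (L′) in the KNSS gauge ⇒ slices of a classical Type-I ancient flow are constant (`ν = 1`) -/

/-- **(L′) ⇒ constant slices, viscosity `1`.**  Assume `TypeIAncientLiouville` (item
stmt-NavierStokesRegularity-4050).  Let `(u, p)` be a classical Navier–Stokes flow (viscosity `1`, zero
force) on `ℝ³ × (−∞,0)` with the global time-Type-I bound `‖u(t,x)‖ ≤ C/√(−t)`.  Then `u(t, ·) ≡ β(t)` is
spatially constant for every `t < 0`.  Proof: S3a gives the continuous intrinsic drift `β`; in the frame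
`B(σ) = ∫_{−1}^σ β` the drift-subtracted field `W(σ,z) = u(σ, z + B(σ)) − β(σ)` satisfies the zero-drift Oseen
identity for all `s < t < 0` (S3b at the anchor `s − 1`, moved to the anchor `−1` by a constant translation),
is continuous, Type-I, divergence free, and jointly smooth (its time translates are bounded Oseen-mild
ancient fields, KNSS Prop. 4.1); (L′) forces `W ≡ 0`. [cite: KochNadirashviliSereginSverak2009, §3 Lemma 3.1, Remark 3.1, §4 Prop. 4.1 (arXiv:0709.3599)] -/
theorem slice_eq_drift_of_typeIAncientLiouville
    (hL : Summit.NavierStokesRegularity.NavierStokesRegularity.Theses.ExtremalTypeIConstant.TypeIAncientLiouville)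
    {C : ℝ} {u : ℝ → EuclideanSpace ℝ (Fin 3) → EuclideanSpace ℝ (Fin 3)} {p : ℝ → EuclideanSpace ℝ (Fin 3) → ℝ}
    (h : IsClassicalNSSolutionOn (Iio 0) 1 0 u p) (hTI : HasTypeITimeDecay C u) :
    ∀ t < 0, ∃ b : EuclideanSpace ℝ (Fin 3), ∀ y, u t y = b := by
  -- S3a: the intrinsic continuous drift
  obtain ⟨β, hβc, hβb, hD⟩ := stub_ancientDriftNormalForm C u p h hTI
  -- S3b: the co-moving zero-drift Oseen identity, anchored at any `a < s`
  have hG := stub_galileanOseenIdentity C u p β h hTI hβc hD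
  set Cβ : ℝ := 8 * C + 32 * oseenSliceConst (EuclideanSpace ℝ (Fin 3)) * C ^ 2 with hCβ_def
  -- interval integrability of `β` between negative times
  have hii : ∀ a b : ℝ, a < 0 → b < 0 → IntervalIntegrable β volume a b := by
    intro a b ha hb
    refine ContinuousOn.intervalIntegrable (hβc.mono fun x hx => ?_)
    have h1 : x ≤ max a b := (mem_uIcc.1 hx).elim (fun h => h.2.trans (le_max_right _ _))
      (fun h => h.2.trans (le_max_left _ _))
    exact lt_of_le_of_lt h1 (max_lt ha hb)
  -- the frame `B(σ) = ∫_{-1}^σ β` and the co-moving field `W`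
  set B : ℝ → EuclideanSpace ℝ (Fin 3) := fun σ => ∫ ρ in (-1:ℝ)..σ, β ρ with hB_def
  set W : ℝ → EuclideanSpace ℝ (Fin 3) → EuclideanSpace ℝ (Fin 3) := fun σ z => u σ (z + B σ) - β σ
    with hW_def
  have hW_apply : ∀ σ z, W σ z = u σ (z + B σ) - β σ := fun σ z => rfl
  -- `B` is differentiable, hence continuous, on `(−∞, 0)`
  have hBderiv : ∀ σ < 0, HasDerivAt B (β σ) σ := by
    intro σ hσ
    have hmeas : StronglyMeasurableAtFilter β (𝓝 σ) volume :=
      hβc.stronglyMeasurableAtFilter isOpen_Iio σ hσ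
    exact intervalIntegral.integral_hasDerivAt_right (hii (-1) σ (by norm_num) hσ) hmeas
      (hβc.continuousAt (isOpen_Iio.mem_nhds hσ))
  have hBcont : ContinuousOn B (Iio 0) := fun σ hσ => (hBderiv σ hσ).continuousAt.continuousWithinAt
  -- (1) the zero-drift Oseen identity for `W`, for ALL `s < t < 0`
  have hWmild : ∀ s t : ℝ, s < t → t < 0 → ∀ x,
      W t x = UnboundedOperators.heatExtension (W s) (t - s) x - oseenDuhamel 1 s W W t x := by
    intro s t hst ht x
    have hs : s < 0 := hst.trans ht
    set a : ℝ := s - 1 with ha_def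
    have has : a < s := by rw [ha_def]; linarith
    have ha0 : a < 0 := has.trans hs
    set c : EuclideanSpace ℝ (Fin 3) := ∫ ρ in a..(-1:ℝ), β ρ with hc_def
    have hsplit : ∀ σ < 0, (∫ ρ in a..σ, β ρ) = c + B σ := fun σ hσ =>
      (intervalIntegral.integral_add_adjacent_intervals (hii a (-1) ha0 (by norm_num))
        (hii (-1) σ (by norm_num) hσ)).symm
    have key := hG a s t has hst ht (x - c)
    -- left-hand side
    have hl : u t (x - c + ∫ ρ in a..t, β ρ) - β t = W t x := by
      rw [hsplit t ht, hW_apply]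
      congr 2
      abel
    -- caloric term
    have hcal : UnboundedOperators.heatExtension (fun z => u s (z + ∫ ρ in a..s, β ρ) - β s) (t - s) (x - c)
        = UnboundedOperators.heatExtension (W s) (t - s) x := by
      have hfun : (fun z => u s (z + ∫ ρ in a..s, β ρ) - β s) = fun z => W s (z + c) := by
        funext z
        rw [hsplit s hs, hW_apply]
        congr 2
        abel
      rw [hfun, heatExtension_comp_add_right, sub_add_cancel]
    -- Duhamel term
    have hduh : oseenDuhamel 1 s (fun σ z => u σ (z + ∫ ρ in a..σ, β ρ) - β σ)
          (fun σ z => u σ (z + ∫ ρ in a..σ, β ρ) - β σ) t (x - c)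
        = oseenDuhamel 1 s W W t x := by
      have hτ : ∀ τ ∈ Ioo s t, (fun z => u τ (z + ∫ ρ in a..τ, β ρ) - β τ) = fun z => W τ (z + c) := by
        intro τ hτ
        funext z
        rw [hsplit τ (hτ.2.trans ht), hW_apply]
        congr 2
        abel
      rw [oseenDuhamel_congr_of_eqOn_Ioo hτ hτ (x - c), oseenDuhamel_comp_add_right, sub_add_cancel]
    rw [hl, hcal, hduh] at key
    exact key
  -- (2) Type-I bound for `W`
  have hWTI : HasTypeITimeDecay (C + Cβ) W := by
    intro σ hσ z
    rw [hW_apply]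
    calc ‖u σ (z + B σ) - β σ‖ ≤ ‖u σ (z + B σ)‖ + ‖β σ‖ := norm_sub_le _ _
      _ ≤ C / Real.sqrt (-σ) + Cβ / Real.sqrt (-σ) := add_le_add (hTI σ hσ _) (hβb σ hσ)
      _ = (C + Cβ) / Real.sqrt (-σ) := by ring
  have hCC : 0 ≤ C + Cβ := by
    have h1 := hWTI (-1) (by norm_num) 0
    have h2 : (0:ℝ) ≤ (C + Cβ) / Real.sqrt (-(-1:ℝ)) := (norm_nonneg _).trans h1
    simpa using h2
  -- (3) continuity of `W` on `(−∞,0) × ℝ³`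
  have hWcont : ContinuousOn (uncurry W) (Iio 0 ×ˢ univ) := by
    have hu : ContinuousOn (uncurry u) (Iio 0 ×ˢ univ) := h.smooth_velocity.continuousOn
    have hΦ : ContinuousOn (fun q : ℝ × EuclideanSpace ℝ (Fin 3) => (q.1, q.2 + B q.1)) (Iio 0 ×ˢ univ) :=
      continuousOn_fst.prodMk (continuousOn_snd.add (hBcont.comp continuousOn_fst fun q hq => hq.1))
    have hmaps : MapsTo (fun q : ℝ × EuclideanSpace ℝ (Fin 3) => (q.1, q.2 + B q.1))
        (Iio 0 ×ˢ univ) (Iio 0 ×ˢ univ) := fun q hq => ⟨hq.1, mem_univ _⟩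
    have hβ' : ContinuousOn (fun q : ℝ × EuclideanSpace ℝ (Fin 3) => β q.1) (Iio 0 ×ˢ univ) :=
      hβc.comp continuousOn_fst fun q hq => hq.1
    have hcomp := (hu.comp hΦ hmaps).sub hβ'
    refine hcomp.congr fun q _ => ?_
    rfl
  -- (4) joint smoothness: the time translates `W(· − ε)` are bounded Oseen-mild ancient fields
  have hsmooth_shift : ∀ ε : ℝ, 0 < ε → IsSmoothSpaceTimeOn (Iio 0) (fun τ => W (τ - ε)) := by
    intro ε hε
    have hcontε : ContinuousOn (uncurry fun τ => W (τ - ε)) (Iio 0 ×ˢ univ) := by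
      have hψ : ContinuousOn (fun q : ℝ × EuclideanSpace ℝ (Fin 3) => (q.1 - ε, q.2)) (Iio 0 ×ˢ univ) :=
        (continuousOn_fst.sub continuousOn_const).prodMk continuousOn_snd
      have hmaps : MapsTo (fun q : ℝ × EuclideanSpace ℝ (Fin 3) => (q.1 - ε, q.2))
          (Iio 0 ×ˢ univ) (Iio 0 ×ˢ univ) := fun q hq =>
        ⟨show q.1 - ε < 0 by have := hq.1; rw [mem_Iio] at this; linarith, mem_univ _⟩
      exact (hWcont.comp hψ hmaps).congr fun q _ => rfl
    have hMε : ∀ τ < 0, ∀ z, ‖W (τ - ε) z‖ ≤ (C + Cβ) / Real.sqrt ε := by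
      intro τ hτ z
      have hτε : τ - ε < 0 := by linarith
      refine (hWTI (τ - ε) hτε z).trans ?_
      exact div_le_div_of_nonneg_left hCC (Real.sqrt_pos.2 hε) (Real.sqrt_le_sqrt (by linarith))
    have hM0 : 0 ≤ (C + Cβ) / Real.sqrt ε := div_nonneg hCC (Real.sqrt_nonneg _)
    have hmildε : ∀ s t : ℝ, s < t → t < 0 → ∀ x,
        W (t - ε) x = UnboundedOperators.heatExtension (W (s - ε)) (t - s) x -
          oseenDuhamel 1 s (fun τ => W (τ - ε)) (fun τ => W (τ - ε)) t x := by
      intro s t hst ht x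
      rw [oseenDuhamel_comp_sub_right, hWmild (s - ε) (t - ε) (by linarith) (by linarith) x]
      congr 2
      ring
    exact HardyAncientLimit.isSmoothSpaceTimeOn_of_oseen hcontε hM0 hMε hmildε
  have hWsmooth : IsSmoothSpaceTimeOn (Iio 0) W := by
    intro z hz
    have hz1 : z.1 < 0 := hz.1
    set ε : ℝ := -z.1 / 2 with hε_def
    have hε : 0 < ε := by rw [hε_def]; linarith
    have hsm := (hsmooth_shift ε hε).comp_add_right ε
    have hfun : (fun t => (fun τ => W (τ - ε)) (t + ε)) = W := by
      funext t
      simp only [add_sub_cancel_right]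
    rw [hfun] at hsm
    have hopen : IsOpen (((· + ε) ⁻¹' Iio (0:ℝ)) ×ˢ (univ : Set (EuclideanSpace ℝ (Fin 3)))) :=
      (isOpen_Iio.preimage (continuous_id.add continuous_const)).prod isOpen_univ
    have hmem : z ∈ ((· + ε) ⁻¹' Iio (0:ℝ)) ×ˢ (univ : Set (EuclideanSpace ℝ (Fin 3))) :=
      ⟨show z.1 + ε < 0 by rw [hε_def]; linarith, mem_univ _⟩
    exact (ContDiffOn.contDiffAt hsm (hopen.mem_nhds hmem)).contDiffWithinAt
  -- (5) divergence-free slices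
  have hWdiv : ∀ σ < 0, VectorCalculus.IsDivFree (W σ) := by
    intro σ hσ x
    have h1 := ((h.divFree σ hσ).comp_add_right (B σ)) x
    simp only [VectorCalculus.divergence] at h1 ⊢
    have hf : fderiv ℝ (W σ) x = fderiv ℝ (fun z => u σ (z + B σ)) x := by
      rw [show W σ = fun z => u σ (z + B σ) - β σ from rfl, fderiv_sub_const]
    rw [hf]
    exact h1
  -- (6) apply (L′) in the KNSS gauge
  have hmildFlow : ∀ s t : ℝ, s < t → t < 0 → ∀ x,
      W t x = heatFlow (W s) (t - s) x - oseenDuhamel 1 s W W t x := by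
    intro s t hst ht x
    rw [heatFlow_of_pos _ (sub_pos.2 hst)]
    exact hWmild s t hst ht x
  have hclass : IsTypeIAncientMild (C + Cβ) W := ⟨hWsmooth, hWdiv, hmildFlow, hWTI⟩
  have hW0 : ∀ t < 0, ∀ x, W t x = 0 := hL (C + Cβ) W (isTypeIAncientMild_iff.1 hclass)
  -- (7) read off the slices of `u`
  intro t ht
  refine ⟨β t, fun y => ?_⟩
  have h1 := hW0 t ht (y - B t)
  rw [hW_apply, sub_add_cancel] at h1
  exact sub_eq_zero.1 h1

/-- **(L′) ⇒ slices of a Type-I classical ancient flow are spatially constant (any viscosity).**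
Assume `TypeIAncientLiouville` (stmt-NavierStokesRegularity-4050).  Let `(v, q)` be a classical
Navier–Stokes flow (viscosity `ν > 0`, zero force) on `ℝ³ × (−∞,0)` with `‖v(t,x)‖ ≤ C/√(−t)`.  Then
`v(t, ·)` is constant for every `t < 0` (viscosity normalisation `w(s,y) = ν^{−1/2} v(s, √ν y)`, which keeps
the Type-I form of the bound with constant `C ν^{−1/2}`, and `slice_eq_drift_of_typeIAncientLiouville`).
[cite: KochNadirashviliSereginSverak2009, §6 (arXiv:0709.3599)] -/
theorem sliceConst_of_typeIAncientLiouville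
    (hL : Summit.NavierStokesRegularity.NavierStokesRegularity.Theses.ExtremalTypeIConstant.TypeIAncientLiouville)
    {ν C : ℝ} (hν : 0 < ν)
    {v : ℝ → EuclideanSpace ℝ (Fin 3) → EuclideanSpace ℝ (Fin 3)} {q : ℝ → EuclideanSpace ℝ (Fin 3) → ℝ}
    (h : IsClassicalNSSolutionOn (Iio 0) ν 0 v q) (hTI : ∀ t < 0, ∀ x, ‖v t x‖ ≤ C / Real.sqrt (-t)) :
    ∀ t < 0, ∀ x y, v t x = v t y := by
  intro τ hτ
  set m : ℝ := Real.sqrt ν with hm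
  have hm0 : 0 < m := Real.sqrt_pos.2 hν
  set w : ℝ → EuclideanSpace ℝ (Fin 3) → EuclideanSpace ℝ (Fin 3) := m⁻¹ • stPull 1 m 0 0 v with hw_def
  have hw : IsClassicalNSSolutionOn (Iio 0) 1 0 w ((m⁻¹ ^ 2) • stPull 1 m 0 0 q) :=
    classical_viscosityNormalise hν h
  have hw_apply : ∀ s y, w s y = m⁻¹ • v s (m • y) := by
    intro s y
    simp [hw_def, stPull]
  have hwTI : HasTypeITimeDecay (m⁻¹ * C) w := by
    intro s hs y
    rw [hw_apply, norm_smul, Real.norm_of_nonneg (inv_nonneg.2 hm0.le), mul_div_assoc]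
    exact mul_le_mul_of_nonneg_left (hTI s hs _) (inv_nonneg.2 hm0.le)
  obtain ⟨b, hb⟩ := slice_eq_drift_of_typeIAncientLiouville hL hw hwTI τ hτ
  have hv : ∀ x, v τ x = m • b := by
    intro x
    have h1 := hb (m⁻¹ • x)
    rw [hw_apply, smul_smul, mul_inv_cancel₀ hm0.ne', one_smul] at h1
    rw [← h1, smul_smul, mul_inv_cancel₀ hm0.ne', one_smul]
  intro x y
  rw [hv x, hv y]

/-- **(L′) ⇒ a Type-I classical ancient flow is irrotational**: `curl v(t, ·) ≡ 0` for every `t < 0`.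
[cite: KochNadirashviliSereginSverak2009, §6 (arXiv:0709.3599)] -/
theorem curl_eq_zero_of_typeIAncientLiouville
    (hL : Summit.NavierStokesRegularity.NavierStokesRegularity.Theses.ExtremalTypeIConstant.TypeIAncientLiouville)
    {ν C : ℝ} (hν : 0 < ν)
    {v : ℝ → EuclideanSpace ℝ (Fin 3) → EuclideanSpace ℝ (Fin 3)} {q : ℝ → EuclideanSpace ℝ (Fin 3) → ℝ}
    (h : IsClassicalNSSolutionOn (Iio 0) ν 0 v q) (hTI : ∀ t < 0, ∀ x, ‖v t x‖ ≤ C / Real.sqrt (-t))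
    {t : ℝ} (ht : t < 0) (x : EuclideanSpace ℝ (Fin 3)) :
    curl (v t) x = 0 := by
  have hc : v t = fun _ => v t 0 := funext fun y => sliceConst_of_typeIAncientLiouville hL hν h hTI t ht y 0
  rw [hc]
  simp [curl]

/-! ### (L′) ⇒ the crux, Stub 3 and S3L -/

/-- **The sharp upper arrow: `TypeIAncientLiouville → FrequencyRigidity`** (item stmt-NavierStokesRegularity-4050
⇒ item stmt-NavierStokesRegularity-2955).  A crux witness `(ν, C, Λ₀, v, q, K)` has `H(−1) = ∫‖curl v(−1)‖²K(−1) > 0`,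
but under (L′) `curl v ≡ 0`.  The frequency clause and the kernel are not used.  CONDITIONAL on (L′)
(explicit hypothesis). [cite: KochNadirashviliSereginSverak2009, §1 p. 3 and §6 (arXiv:0709.3599)] -/
theorem frequencyRigidity_of_typeIAncientLiouville :
    Summit.NavierStokesRegularity.NavierStokesRegularity.Theses.ExtremalTypeIConstant.TypeIAncientLiouville →
      Summit.NavierStokesRegularity.NavierStokesRegularity.Theses.AdaptedFrequency.FrequencyRigidity := by
  intro hL
  unfold Theses.AdaptedFrequency.FrequencyRigidity
  rintro ⟨ν, C, Λ₀, v, q, K, hν, hNS, hTI, -, -, -, -, -, -, hF⟩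
  have hpos := (hF _ _ rfl rfl).1 (-1) (by norm_num)
  have hzero : (∫ x, ‖curl (v (-1)) x‖ ^ 2 * K (-1) x) = 0 := by
    have hc : ∀ x, curl (v (-1)) x = 0 := fun x =>
      curl_eq_zero_of_typeIAncientLiouville hL hν hNS (fun t ht x => hTI t ht x) (by norm_num) x
    simp [hc]
  rw [hzero] at hpos
  exact lt_irrefl _ hpos

/-- **(L′) ⇒ Stub 3 of line `two-ended-pinning`** (`stub_flatEnstrophyLiouville`, registered signature
verbatim): a flat inhabitant has `H(−1) = A > 0`, but under (L′) `curl v ≡ 0` and `H(−1) = 0`.  CONDITIONAL on (L′).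
[cite: KochNadirashviliSereginSverak2009, §6 (arXiv:0709.3599)] -/
theorem stub_flatEnstrophyLiouville_of_typeIAncientLiouville
    (hL : Summit.NavierStokesRegularity.NavierStokesRegularity.Theses.ExtremalTypeIConstant.TypeIAncientLiouville) :
    ∀ (ν C A : ℝ) (C' : ℕ → ℝ) (v : ℝ → EuclideanSpace ℝ (Fin 3) → EuclideanSpace ℝ (Fin 3))
      (q : ℝ → EuclideanSpace ℝ (Fin 3) → ℝ) (K : ℝ → EuclideanSpace ℝ (Fin 3) → ℝ),
      ¬ (0 < ν ∧ Literature.Analysis.FluidPDE.IsClassicalNSSolutionOn (Set.Iio 0) ν 0 v q ∧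
          Literature.Analysis.FluidPDE.HasTypeITimeDecay C v ∧
          (∀ k : ℕ, 1 ≤ k → ∀ t : ℝ, t < 0 → ∀ x : EuclideanSpace ℝ (Fin 3),
            ‖iteratedFDeriv ℝ k (v t) x‖ ≤ C' k * (-t) ^ (-((k : ℝ) + 1) / 2)) ∧
          Literature.Analysis.FluidPDE.IsAdaptedBackwardKernel ν v (Set.Iio 0) 0 0 K ∧
          Literature.Analysis.FluidPDE.IsGaussianComparable K (Set.Iio 0) 0 0 ∧ 0 < A ∧
          (∀ t : ℝ, t < 0 →
            Literature.Analysis.FluidPDE.adaptedEnstrophy v K t = A * (-t) ^ (-(2 : ℝ))) ∧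
          (∀ t : ℝ, t < 0 →
            HasDerivAt (Literature.Analysis.FluidPDE.adaptedEnstrophy v K)
              (∫ x, (2 * (inner ℝ (Literature.Analysis.FluidPDE.curl (v t) x)
                            (fderiv ℝ (v t) x (Literature.Analysis.FluidPDE.curl (v t) x))
                          - ν * Literature.Analysis.FluidPDE.frobeniusNormSq
                            (fderiv ℝ (Literature.Analysis.FluidPDE.curl (v t)) x))) * K t x) t)) := by
  rintro ν C A C' v q K ⟨hν, hNS, hTI, -, -, -, hA, hflat, -⟩
  have h1 := hflat (-1) (by norm_num)
  have hc : ∀ x, curl (v (-1)) x = 0 := fun x =>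
    curl_eq_zero_of_typeIAncientLiouville hL hν hNS (fun t ht x => hTI t ht x) (by norm_num) x
  have hzero : adaptedEnstrophy v K (-1) = 0 := by
    simp [adaptedEnstrophy, hc]
  rw [hzero] at h1
  norm_num at h1
  linarith

/-- **(L′) ⇒ S3L**, the large-constant half of Stub 3 (`stub_flatEnstrophyLiouville_largeConstant`, the ONE
open stub of skeleton v6.2/v7, registered signature verbatim; the size hypothesis is not needed under (L′)).
CONDITIONAL on (L′). [cite: KochNadirashviliSereginSverak2009, §6 (arXiv:0709.3599)] -/
theorem stub_flatEnstrophyLiouville_largeConstant_of_typeIAncientLiouville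
    (hL : Summit.NavierStokesRegularity.NavierStokesRegularity.Theses.ExtremalTypeIConstant.TypeIAncientLiouville) :
    ∀ (ν C A : ℝ) (C' : ℕ → ℝ) (v : ℝ → EuclideanSpace ℝ (Fin 3) → EuclideanSpace ℝ (Fin 3))
      (q : ℝ → EuclideanSpace ℝ (Fin 3) → ℝ) (K : ℝ → EuclideanSpace ℝ (Fin 3) → ℝ),
      1 / (96 * Literature.Analysis.FluidPDE.oseenSliceConst (EuclideanSpace ℝ (Fin 3))) ≤ C / Real.sqrt ν →
      ¬ (0 < ν ∧ Literature.Analysis.FluidPDE.IsClassicalNSSolutionOn (Set.Iio 0) ν 0 v q ∧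
          Literature.Analysis.FluidPDE.HasTypeITimeDecay C v ∧
          (∀ k : ℕ, 1 ≤ k → ∀ t : ℝ, t < 0 → ∀ x : EuclideanSpace ℝ (Fin 3),
            ‖iteratedFDeriv ℝ k (v t) x‖ ≤ C' k * (-t) ^ (-((k : ℝ) + 1) / 2)) ∧
          Literature.Analysis.FluidPDE.IsAdaptedBackwardKernel ν v (Set.Iio 0) 0 0 K ∧
          Literature.Analysis.FluidPDE.IsGaussianComparable K (Set.Iio 0) 0 0 ∧ 0 < A ∧
          (∀ t : ℝ, t < 0 →
            Literature.Analysis.FluidPDE.adaptedEnstrophy v K t = A * (-t) ^ (-(2 : ℝ))) ∧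
          (∀ t : ℝ, t < 0 →
            HasDerivAt (Literature.Analysis.FluidPDE.adaptedEnstrophy v K)
              (∫ x, (2 * (inner ℝ (Literature.Analysis.FluidPDE.curl (v t) x)
                            (fderiv ℝ (v t) x (Literature.Analysis.FluidPDE.curl (v t) x))
                          - ν * Literature.Analysis.FluidPDE.frobeniusNormSq
                            (fderiv ℝ (Literature.Analysis.FluidPDE.curl (v t)) x))) * K t x) t)) :=
  fun ν C A C' v q K _ => stub_flatEnstrophyLiouville_of_typeIAncientLiouville hL ν C A C' v q K

/-- **(L) ⇒ (L′) read on classical flows is consistent with p107437**: under (L′) the conclusion of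
`sliceConst_of_liouvilleConjectureNS` holds with (L) replaced by the weaker (L′) — recorded as the statement
that (L′) already yields everything the line used (L) for. [cite: KochNadirashviliSereginSverak2009, §1 p. 3 and §6 (arXiv:0709.3599)] -/
theorem hasTypeITimeDecay_sliceConst_of_typeIAncientLiouville
    (hL : Summit.NavierStokesRegularity.NavierStokesRegularity.Theses.ExtremalTypeIConstant.TypeIAncientLiouville)
    {ν C : ℝ} (hν : 0 < ν)
    {v : ℝ → EuclideanSpace ℝ (Fin 3) → EuclideanSpace ℝ (Fin 3)} {q : ℝ → EuclideanSpace ℝ (Fin 3) → ℝ}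
    (h : IsClassicalNSSolutionOn (Iio 0) ν 0 v q) (hTI : HasTypeITimeDecay C v) :
    ∀ t < 0, ∃ b : EuclideanSpace ℝ (Fin 3), v t = fun _ => b :=
  fun t ht => ⟨v t 0, funext fun y => sliceConst_of_typeIAncientLiouville hL hν h (fun s hs x => hTI s hs x) t ht y 0⟩

end Summit.NavierStokesRegularity.NavierStokesRegularity.Theorems.FrequencyRigidity.TwoEndedPinning

end
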